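import Literature.MathematicalPhysics.QuantumLattice.HubbardLangerMattisTorus
import HarnessLib

/-!
# Ventures/CertifiedManyBodySolver — Lower/PauliDoublonOperatorIdentity.lean: the plane-wave operator identity (LEMMA A, proved)

HONEST FRAMING: first certified bounds; not a superconductivity verdict; every number certified or labelled float.

Part 3/4 of the Pauli–doublon floor (see `Lower/PauliDoublonFloor.lean`). On the torus `(ℤ/Lℤ)^d`, `L ≥ 3`, with
site plane waves `e_k` (columns of `sitePlaneWave`, [cite: FriedliVelenikSMLS2017, §10.5.2]) and the occupied-site
projection `Π_w`: the rank-two data `(Π_{wᶜ} e_k, Π_w e_k)` have Gram matrix `diag(1 − |w|/L^d, |w|/L^d)` for EVERY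
`k` and every `w` of that size (`|e_k(x)|² = L^{−d}`; the Harris–Lange spectral-weight caps read as Loewner bounds,
[cite: HarrisLange1967, §III]), the mixed Gram entry vanishes, and Langer–Mattis' frozen one-body matrix
`A_w = −tA + (U/2)1_w` [cite: LangerMattis1971, eq. (5)] satisfies, traced against any Hermitian `γ`,
`Re Tr(A_w γ) + α Re Tr γ = Σ_k [(−ε_k+α) g₁₁(k) + 2(−ε_k+ν) g₁₂(k) + (−ε_k+α+U/2) g₂₂(k)]`
(`re_trace_lmOneBody_mul_add`; the `ν`-term is free because `Π_{wᶜ} Π_w = 0`). Mathematics and Lean proofs: hubbard-alg L3 seat B (planner-sr-mbsolver-l3-idea-2 g25/g26, `HOME/hubbard-alg/L3-hybrid/tools-seatB/pdbl/NOTE-PDB-L.md` §6, `PauliDoublonSketch.lean` v6 sha16 54e19fa031dc4b1e); tree placement and citations: LIT lane (literature-prover lit-1 g22). 0 sorry.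
-/

noncomputable section

namespace Summit.Ventures.CertifiedManyBodySolver.Lower

namespace PauliDoublon

open Literature.MathematicalPhysics.QuantumLattice
open Matrix Finset Filter Literature.Probability.LatticeModels ThermodynamicLimit LangerMattis MeasureTheory
open scoped Topology ComplexOrder ComplexConjugate

variable {d L : ℕ} [NeZero L]

/-- The occupied-site projection `1_w` as a `0/1` diagonal matrix. [folklore] -/
def occProj (w : Finset (FermionTorus d L)) : Matrix (FermionTorus d L) (FermionTorus d L) ℂ :=
  diagonal fun x => if x ∈ w then (1 : ℂ) else 0

omit [NeZero L] in
/-- `A_w = −(hopping matrix) + (U/2) Π_w`. [cite: LangerMattis1971, eq. (5)] -/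
theorem lmOneBody_eq (t U : ℝ) (w : Finset (FermionTorus d L)) :
    lmOneBody (fermionTorusGraph d L) t U w =
      -hopMatrix (fermionTorusGraph d L) t + ((U / 2 : ℝ) : ℂ) • occProj w := by
  ext x y
  simp only [lmOneBody, hopMatrix, occProj, Matrix.of_apply, Matrix.add_apply, Matrix.neg_apply,
    Matrix.smul_apply, diagonal_apply, smul_eq_mul]
  split_ifs <;> simp_all

/-- The occupied part `1_w W` of the site plane waves (columns `g_k = 1_w e_k`). [folklore] -/
def occWave (w : Finset (FermionTorus d L)) : Matrix (FermionTorus d L) (FermionTorus d L) ℂ :=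
  Matrix.of fun x k => if x ∈ w then sitePlaneWave d L x k else 0

/-- The free part `(1 - 1_w) W` of the site plane waves (columns `f_k = (1 - 1_w) e_k`). [folklore] -/
def freeWave (w : Finset (FermionTorus d L)) : Matrix (FermionTorus d L) (FermionTorus d L) ℂ :=
  Matrix.of fun x k => if x ∈ w then 0 else sitePlaneWave d L x k

/-- `Π_w W` as a product. [folklore] -/
theorem occWave_eq (w : Finset (FermionTorus d L)) : occWave w = occProj w * sitePlaneWave d L := by
  ext x k
  simp only [occWave, occProj, Matrix.of_apply, diagonal_mul]
  split_ifs <;> simp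

/-- `Π_{wᶜ} W + Π_w W = W`. [folklore] -/
theorem freeWave_add_occWave (w : Finset (FermionTorus d L)) :
    freeWave w + occWave w = sitePlaneWave d L := by
  ext x k
  simp only [freeWave, occWave, Matrix.add_apply, Matrix.of_apply]
  split_ifs <;> simp

/-- `|W_{x,k}|² = L^{-d}`. [cite: FriedliVelenikSMLS2017, §10.5.2] -/
theorem star_sitePlaneWave_mul_self (x k : FermionTorus d L) :
    star (sitePlaneWave d L x k) * sitePlaneWave d L x k = ((L : ℂ) ^ d)⁻¹ := by
  simp only [sitePlaneWave, Matrix.of_apply, star_mul', star_torusFourierWeight, Complex.star_def]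
  have h := torusChar_mul_conj k.toTorusSite x.toTorusSite
  calc torusFourierWeight d L * conj (torusChar k.toTorusSite x.toTorusSite) *
        (torusFourierWeight d L * torusChar k.toTorusSite x.toTorusSite)
      = (torusFourierWeight d L * torusFourierWeight d L) *
          (torusChar k.toTorusSite x.toTorusSite * conj (torusChar k.toTorusSite x.toTorusSite)) := by
        ring
    _ = ((L : ℂ) ^ d)⁻¹ := by rw [h, torusFourierWeight_mul_self, mul_one]

/-- `‖g_k‖² = |w|/L^d`. [cite: HarrisLange1967, §III (spectral-weight caps)] -/
theorem occWave_gram (w : Finset (FermionTorus d L)) (k : FermionTorus d L) :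
    ((occWave w)ᴴ * occWave w) k k = (w.card : ℂ) * ((L : ℂ) ^ d)⁻¹ := by
  rw [Matrix.mul_apply]
  have h : ∀ x, (occWave w)ᴴ k x * occWave w x k = if x ∈ w then ((L : ℂ) ^ d)⁻¹ else 0 := by
    intro x
    rw [conjTranspose_apply]
    simp only [occWave, Matrix.of_apply]
    split_ifs with hx
    · exact star_sitePlaneWave_mul_self x k
    · simp
  simp_rw [h]
  rw [Finset.sum_ite_mem, Finset.univ_inter, Finset.sum_const, nsmul_eq_mul]

/-- `‖f_k‖² = 1 - |w|/L^d`. [cite: HarrisLange1967, §III (spectral-weight caps)] -/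
theorem freeWave_gram (w : Finset (FermionTorus d L)) (k : FermionTorus d L) :
    ((freeWave w)ᴴ * freeWave w) k k = 1 - (w.card : ℂ) * ((L : ℂ) ^ d)⁻¹ := by
  rw [Matrix.mul_apply]
  have h : ∀ x, (freeWave w)ᴴ k x * freeWave w x k =
      ((L : ℂ) ^ d)⁻¹ - (if x ∈ w then ((L : ℂ) ^ d)⁻¹ else 0) := by
    intro x
    rw [conjTranspose_apply]
    simp only [freeWave, Matrix.of_apply]
    split_ifs with hx
    · simp
    · rw [star_sitePlaneWave_mul_self x k, sub_zero]
  simp_rw [h]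
  rw [Finset.sum_sub_distrib, Finset.sum_ite_mem, Finset.univ_inter, Finset.sum_const,
    Finset.sum_const, nsmul_eq_mul, nsmul_eq_mul, Finset.card_univ, LangerMattis.card_fermionTorus_eq]
  push_cast
  rw [mul_inv_cancel₀ (pow_ne_zero _ (Nat.cast_ne_zero.mpr (NeZero.ne L)))]

/-- `⟨f_k, g_k⟩ = 0` (disjoint supports). [folklore] -/
theorem freeWave_occWave_gram (w : Finset (FermionTorus d L)) (k : FermionTorus d L) :
    ((freeWave w)ᴴ * occWave w) k k = 0 := by
  rw [Matrix.mul_apply]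
  refine Finset.sum_eq_zero fun x _ => ?_
  rw [conjTranspose_apply]
  simp only [freeWave, occWave, Matrix.of_apply]
  split_ifs <;> simp

/-- The mixed Gram entry `⟨Π_w e_k, Π_{wᶜ} e_k⟩ = 0`. [folklore] -/
theorem occWave_freeWave_gram (w : Finset (FermionTorus d L)) (k : FermionTorus d L) :
    ((occWave w)ᴴ * freeWave w) k k = 0 := by
  rw [Matrix.mul_apply]
  refine Finset.sum_eq_zero fun x _ => ?_
  rw [conjTranspose_apply]
  simp only [freeWave, occWave, Matrix.of_apply]
  split_ifs <;> simp

/-- Sandwich forms are matrix entries: `⟨X e_k, M Y e_k'⟩ = (Xᴴ M Y)_{k k'}`. [folklore] -/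
theorem star_col_dotProduct_mulVec_col {ι : Type*} [Fintype ι] (X M Y : Matrix ι ι ℂ) (k k' : ι) :
    star (fun x => X x k) ⬝ᵥ (M *ᵥ fun x => Y x k') = (Xᴴ * M * Y) k k' := by
  simp only [dotProduct, mulVec, Matrix.mul_apply, conjTranspose_apply, Pi.star_apply, Finset.mul_sum,
    Finset.sum_mul, mul_assoc]
  exact Finset.sum_comm

/-- Expansion of the form on a real combination of two vectors. [folklore] -/
theorem form_expand {ι : Type*} [Fintype ι] (M : Matrix ι ι ℂ) (u v : ι → ℂ) (c₁ c₂ : ℝ) :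
    star ((c₁ : ℂ) • u + (c₂ : ℂ) • v) ⬝ᵥ (M *ᵥ ((c₁ : ℂ) • u + (c₂ : ℂ) • v)) =
      ((c₁ * c₁ : ℝ) : ℂ) * (star u ⬝ᵥ (M *ᵥ u)) +
        ((c₁ * c₂ : ℝ) : ℂ) * (star u ⬝ᵥ (M *ᵥ v) + star v ⬝ᵥ (M *ᵥ u)) +
          ((c₂ * c₂ : ℝ) : ℂ) * (star v ⬝ᵥ (M *ᵥ v)) := by
  simp only [mulVec_add, mulVec_smul, dotProduct_add, dotProduct_smul, star_add, star_smul,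
    add_dotProduct, smul_dotProduct, smul_eq_mul, Complex.star_def, Complex.conj_ofReal]
  push_cast
  ring

/-- `Re ⟨v, M u⟩ = Re ⟨u, M v⟩` for Hermitian `M`. [folklore] -/
theorem re_form_comm {ι : Type*} [Fintype ι] {M : Matrix ι ι ℂ} (hM : M.IsHermitian) (u v : ι → ℂ) :
    (star v ⬝ᵥ (M *ᵥ u)).re = (star u ⬝ᵥ (M *ᵥ v)).re := by
  have h : star (star u ⬝ᵥ (M *ᵥ v)) = star v ⬝ᵥ (M *ᵥ u) := by
    rw [star_dotProduct, star_star, star_mulVec, ← dotProduct_mulVec, hM.eq]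
  rw [← h, Complex.star_def, Complex.conj_re]

/-- The real `2×2` data of a density matrix `γ` at momentum `k`: `g₁₁ = Re(f_kᴴ γ f_k)`. [folklore] -/
def gFF (w : Finset (FermionTorus d L)) (γ : Matrix (FermionTorus d L) (FermionTorus d L) ℂ)
    (k : FermionTorus d L) : ℝ := (((freeWave w)ᴴ * γ * freeWave w) k k).re

/-- `g₁₂ = Re(f_kᴴ γ g_k)`. [folklore] -/
def gFO (w : Finset (FermionTorus d L)) (γ : Matrix (FermionTorus d L) (FermionTorus d L) ℂ)
    (k : FermionTorus d L) : ℝ := (((freeWave w)ᴴ * γ * occWave w) k k).re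

/-- `g₂₂ = Re(g_kᴴ γ g_k)`. [folklore] -/
def gOO (w : Finset (FermionTorus d L)) (γ : Matrix (FermionTorus d L) (FermionTorus d L) ℂ)
    (k : FermionTorus d L) : ℝ := (((occWave w)ᴴ * γ * occWave w) k k).re

/-- The per-momentum `2×2` data of a density matrix `0 ⪯ γ ⪯ 1` satisfy the two quadratic-form
hypotheses of `RankTwoFloorQF` with `κ = |w|/L^d`. [folklore] -/
theorem rankTwo_data (w : Finset (FermionTorus d L)) (k : FermionTorus d L)
    {γ : Matrix (FermionTorus d L) (FermionTorus d L) ℂ} (hγ : γ.PosSemidef) (hγ' : (1 - γ).PosSemidef) :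
    (∀ c₁ c₂ : ℝ, 0 ≤ gFF w γ k * (c₁ * c₁) + 2 * gFO w γ k * (c₁ * c₂) + gOO w γ k * (c₂ * c₂)) ∧
    (∀ c₁ c₂ : ℝ, 0 ≤ (1 - (w.card : ℝ) / (L : ℝ) ^ d - gFF w γ k) * (c₁ * c₁) -
        2 * gFO w γ k * (c₁ * c₂) + ((w.card : ℝ) / (L : ℝ) ^ d - gOO w γ k) * (c₂ * c₂)) := by
  simp only [gFF, gFO, gOO]
  set u : FermionTorus d L → ℂ := fun x => freeWave w x k with hu
  set v : FermionTorus d L → ℂ := fun x => occWave w x k with hv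
  have huu : star u ⬝ᵥ (γ *ᵥ u) = ((freeWave w)ᴴ * γ * freeWave w) k k :=
    star_col_dotProduct_mulVec_col _ _ _ k k
  have huv : star u ⬝ᵥ (γ *ᵥ v) = ((freeWave w)ᴴ * γ * occWave w) k k :=
    star_col_dotProduct_mulVec_col _ _ _ k k
  have hvv : star v ⬝ᵥ (γ *ᵥ v) = ((occWave w)ᴴ * γ * occWave w) k k :=
    star_col_dotProduct_mulVec_col _ _ _ k k
  have hvu : (star v ⬝ᵥ (γ *ᵥ u)).re = (star u ⬝ᵥ (γ *ᵥ v)).re := re_form_comm hγ.1 u v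
  -- Gram data of `(u, v)`
  have guu : star u ⬝ᵥ u = 1 - (w.card : ℂ) * ((L : ℂ) ^ d)⁻¹ := by
    have h := star_col_dotProduct_mulVec_col (freeWave w) 1 (freeWave w) k k
    rwa [one_mulVec, Matrix.mul_one, freeWave_gram] at h
  have gvv : star v ⬝ᵥ v = (w.card : ℂ) * ((L : ℂ) ^ d)⁻¹ := by
    have h := star_col_dotProduct_mulVec_col (occWave w) 1 (occWave w) k k
    rwa [one_mulVec, Matrix.mul_one, occWave_gram] at h
  have guv : star u ⬝ᵥ v = 0 := by
    have h := star_col_dotProduct_mulVec_col (freeWave w) 1 (occWave w) k k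
    rwa [one_mulVec, Matrix.mul_one, freeWave_occWave_gram] at h
  have gvu : star v ⬝ᵥ u = 0 := by
    have h := star_col_dotProduct_mulVec_col (occWave w) 1 (freeWave w) k k
    rwa [one_mulVec, Matrix.mul_one, occWave_freeWave_gram] at h
  refine ⟨fun c₁ c₂ => ?_, fun c₁ c₂ => ?_⟩
  · have h0 := hγ.dotProduct_mulVec_nonneg ((c₁ : ℂ) • u + (c₂ : ℂ) • v)
    rw [form_expand] at h0
    have h1 := (Complex.nonneg_iff.mp h0).1
    simp only [Complex.add_re, Complex.re_ofReal_mul] at h1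
    rw [hvu, huu, huv, hvv] at h1
    nlinarith [h1]
  · have h0 := hγ'.dotProduct_mulVec_nonneg ((c₁ : ℂ) • u + (c₂ : ℂ) • v)
    rw [form_expand] at h0
    have h1 := (Complex.nonneg_iff.mp h0).1
    simp only [sub_mulVec, one_mulVec, dotProduct_sub, Complex.add_re, Complex.sub_re,
      Complex.re_ofReal_mul] at h1
    rw [hvu, huu, huv, hvv, guu, gvv, guv, gvu] at h1
    have hc : ((w.card : ℂ) * ((L : ℂ) ^ d)⁻¹).re = (w.card : ℝ) / (L : ℝ) ^ d := by
      rw [← Complex.ofReal_natCast, ← Complex.ofReal_natCast, ← Complex.ofReal_pow,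
        ← Complex.ofReal_inv, ← Complex.ofReal_mul, Complex.ofReal_re, div_eq_mul_inv]
    have hc' : (1 - (w.card : ℂ) * ((L : ℂ) ^ d)⁻¹).re = 1 - (w.card : ℝ) / (L : ℝ) ^ d := by
      rw [Complex.sub_re, Complex.one_re, hc]
    rw [hc, hc'] at h1
    simp only [Complex.zero_re] at h1
    nlinarith [h1]

omit [NeZero L] in
/-- `Π_w² = Π_w`. [folklore] -/
theorem occProj_mul_self (w : Finset (FermionTorus d L)) : occProj w * occProj w = occProj w := by
  unfold occProj
  rw [diagonal_mul_diagonal]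
  congr 1
  funext x
  split_ifs <;> simp

omit [NeZero L] in
/-- `Π_wᴴ = Π_w`. [folklore] -/
theorem occProj_conjTranspose (w : Finset (FermionTorus d L)) : (occProj w)ᴴ = occProj w := by
  ext x y
  simp only [occProj, conjTranspose_apply, diagonal_apply]
  by_cases h : y = x
  · subst h
    by_cases hx : y ∈ w <;> simp [hx]
  · have h' : ¬ x = y := fun e => h e.symm
    simp [h, h']

/-- `Π_{wᶜ} W = W − Π_w W`. [folklore] -/
theorem freeWave_eq (w : Finset (FermionTorus d L)) :
    freeWave w = (1 - occProj w) * sitePlaneWave d L := by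
  rw [eq_sub_of_add_eq (freeWave_add_occWave w), occWave_eq, Matrix.sub_mul, Matrix.one_mul]

/-- `(Π_w W)(Π_{wᶜ} W)ᴴ = 0` (uses `W Wᴴ = 1`, `Π_w Π_{wᶜ} = 0`). [folklore] -/
theorem occWave_mul_freeWave_conjTranspose (w : Finset (FermionTorus d L)) :
    occWave w * (freeWave w)ᴴ = 0 := by
  rw [freeWave_eq, occWave_eq, conjTranspose_mul, conjTranspose_sub, conjTranspose_one,
    occProj_conjTranspose]
  simp only [Matrix.mul_assoc]
  rw [← Matrix.mul_assoc (sitePlaneWave d L), sitePlaneWave_mul_conjTranspose, Matrix.one_mul,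
    Matrix.mul_sub, Matrix.mul_one, occProj_mul_self, sub_self]

/-- **LEMMA A, traced against `γ` (kernel-checked).** For Hermitian `γ` and `L ≥ 3`:
`Re Tr(A_w γ) + α Re Tr γ = Σ_k [(-ε_k+α) g₁₁(k) + 2(-ε_k+ν) g₁₂(k) + (-ε_k+α+U/2) g₂₂(k)]`,
`ε_k = siteBand t k`; the `ν`-term is free because `Σ_k f_k g_kᴴ = (1-1_w) W Wᴴ 1_w = 0`. [folklore] -/
theorem re_trace_lmOneBody_mul_add (hL : 3 ≤ L) (t U α ν : ℝ) (w : Finset (FermionTorus d L))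
    {γ : Matrix (FermionTorus d L) (FermionTorus d L) ℂ} (hγH : γ.IsHermitian) :
    (Matrix.trace (lmOneBody (fermionTorusGraph d L) t U w * γ)).re + α * (Matrix.trace γ).re =
      ∑ k, ((-siteBand t k + α) * gFF w γ k + 2 * (-siteBand t k + ν) * gFO w γ k +
        (-siteBand t k + α + U / 2) * gOO w γ k) := by
  set W := sitePlaneWave d L with hW
  set F := freeWave w with hF
  set O := occWave w with hO
  set D : Matrix (FermionTorus d L) (FermionTorus d L) ℂ :=
    diagonal (fun k => ((siteBand t k : ℝ) : ℂ)) with hD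
  -- S1: the hopping trace in the plane-wave basis
  have S1 : Matrix.trace (hopMatrix (fermionTorusGraph d L) t * γ) =
      ∑ k, ((siteBand t k : ℝ) : ℂ) * (Wᴴ * γ * W) k k := by
    rw [hopMatrix_torus_eq_conj hL t, ← hW, ← hD]
    rw [show W * D * Wᴴ * γ = W * (D * (Wᴴ * γ)) by simp only [Matrix.mul_assoc],
      Matrix.trace_mul_comm,
      show D * (Wᴴ * γ) * W = D * (Wᴴ * γ * W) by simp only [Matrix.mul_assoc]]
    simp only [Matrix.trace, Matrix.diag_apply, hD, diagonal_mul]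
  -- S2: the trace of γ in the plane-wave basis
  have S2 : Matrix.trace γ = ∑ k, (Wᴴ * γ * W) k k := by
    have h : Matrix.trace (Wᴴ * γ * W) = Matrix.trace γ := by
      rw [Matrix.trace_mul_cycle, hW, sitePlaneWave_mul_conjTranspose, Matrix.one_mul]
    rw [← h]
    simp only [Matrix.trace, Matrix.diag_apply]
  -- S3: the trace of 1_w γ
  have S3 : Matrix.trace (occProj w * γ) = ∑ k, (Oᴴ * γ * O) k k := by
    have h1 : Oᴴ * γ * O = Wᴴ * (occProj w * γ * occProj w) * W := by
      rw [hO, occWave_eq, conjTranspose_mul, occProj_conjTranspose]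
      simp only [Matrix.mul_assoc, hW]
    have h2 : Matrix.trace (Wᴴ * (occProj w * γ * occProj w) * W) = Matrix.trace (occProj w * γ) := by
      rw [Matrix.trace_mul_cycle, hW, sitePlaneWave_mul_conjTranspose, Matrix.one_mul,
        Matrix.trace_mul_cycle, occProj_mul_self]
    rw [h1, ← h2]
    simp only [Matrix.trace, Matrix.diag_apply]
  -- S4: block decomposition W = F + O
  have S4 : Wᴴ * γ * W = Fᴴ * γ * F + Fᴴ * γ * O + Oᴴ * γ * F + Oᴴ * γ * O := by
    rw [hW, ← freeWave_add_occWave w, ← hF, ← hO, conjTranspose_add, Matrix.add_mul, Matrix.mul_add,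
      Matrix.add_mul, Matrix.add_mul]
    abel
  -- S5: the mixed blocks are traceless
  have S5a : ∑ k, (Fᴴ * γ * O) k k = 0 := by
    have h : Matrix.trace (Fᴴ * γ * O) = 0 := by
      rw [Matrix.trace_mul_cycle, hO, hF, occWave_mul_freeWave_conjTranspose, Matrix.zero_mul,
        Matrix.trace_zero]
    simpa only [Matrix.trace, Matrix.diag_apply] using h
  have hre : ∀ k, ((Oᴴ * γ * F) k k).re = ((Fᴴ * γ * O) k k).re := by
    intro k
    have h : Oᴴ * γ * F = (Fᴴ * γ * O)ᴴ := by
      rw [conjTranspose_mul, conjTranspose_mul, conjTranspose_conjTranspose, hγH.eq, Matrix.mul_assoc]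
    rw [h, conjTranspose_apply, Complex.star_def, Complex.conj_re]
  -- real parts
  have hA : Matrix.trace (lmOneBody (fermionTorusGraph d L) t U w * γ) =
      -Matrix.trace (hopMatrix (fermionTorusGraph d L) t * γ) +
        ((U / 2 : ℝ) : ℂ) * Matrix.trace (occProj w * γ) := by
    rw [lmOneBody_eq, Matrix.add_mul, Matrix.neg_mul, Matrix.smul_mul, Matrix.trace_add,
      Matrix.trace_neg, Matrix.trace_smul, smul_eq_mul]
  have hb0 : ∑ k, gFO w γ k = 0 := by
    have h := congrArg Complex.re S5a
    rw [Complex.re_sum] at h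
    simpa only [gFO, Complex.zero_re] using h
  have HH : (Matrix.trace (hopMatrix (fermionTorusGraph d L) t * γ)).re =
      ∑ k, siteBand t k * (gFF w γ k + 2 * gFO w γ k + gOO w γ k) := by
    rw [S1, Complex.re_sum]
    refine Finset.sum_congr rfl fun k _ => ?_
    rw [Complex.re_ofReal_mul, S4]
    simp only [Matrix.add_apply, Complex.add_re, hre k, gFF, gFO, gOO]
    ring
  have HG : (Matrix.trace γ).re = ∑ k, (gFF w γ k + 2 * gFO w γ k + gOO w γ k) := by
    rw [S2, Complex.re_sum]
    refine Finset.sum_congr rfl fun k _ => ?_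
    rw [S4]
    simp only [Matrix.add_apply, Complex.add_re, hre k, gFF, gFO, gOO]
    ring
  have HP : (Matrix.trace (occProj w * γ)).re = ∑ k, gOO w γ k := by
    rw [S3, Complex.re_sum]
    rfl
  rw [hA, Complex.add_re, Complex.neg_re, Complex.re_ofReal_mul, HH, HG, HP]
  have hR : ∑ k, ((-siteBand t k + α) * gFF w γ k + 2 * (-siteBand t k + ν) * gFO w γ k +
      (-siteBand t k + α + U / 2) * gOO w γ k) =
      (-∑ k, siteBand t k * (gFF w γ k + 2 * gFO w γ k + gOO w γ k) + U / 2 * ∑ k, gOO w γ k +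
        α * ∑ k, (gFF w γ k + 2 * gFO w γ k + gOO w γ k)) - 2 * (α - ν) * ∑ k, gFO w γ k := by
    rw [Finset.mul_sum, Finset.mul_sum, Finset.mul_sum, ← Finset.sum_neg_distrib,
      ← Finset.sum_add_distrib, ← Finset.sum_add_distrib, ← Finset.sum_sub_distrib]
    exact Finset.sum_congr rfl fun k _ => by ring
  rw [hR, hb0, mul_zero, sub_zero]

end PauliDoublon

end Summit.Ventures.CertifiedManyBodySolver.Lower
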